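import Summits.ValiantsHypothesis.ValiantsHypothesis.Theses.SOSTau

/-!
# Negative lemma around crux `SOSTau` (route SOSTau, item stmt-ValiantsHypothesis-18748):
# TIGHTNESS at the Chebyshev family — the constant cannot be `3`

Crux-disprover artefact (cdisprove cycle 1).  It does not refute `SOSTau`; it kernel-checks the
calibration that every earlier seat used on paper: the doubling `T_{4m} = 2·T_{2m}² − 1·1²` is a
weighted two-square representation of support-sum `≤ (m + 1) + 1` (because `T_{2m}` is an EVEN
polynomial of degree `2m`) of a polynomial with `4m` distinct real zeros.  Hence

* `four_mul_le_of_sosTauConst` — any admissible constant `c` satisfies `4m ≤ c·(m + 2)` for all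
  `m` (ratio `Z/S → 4` along the family: the bound is ATTAINED asymptotically at `c = 4`);
* `not_sosTau_const_three` — the natural strengthening "`SOSTau` with constant `3`" is FALSE
  (`m = 7`: `T₂₈`, 28 zeros, support-sum 9).

Ingredients proved here: coefficient parity of `T_n` (`coeff_chebyshevT_eq_zero_of_odd_add`),
`|supp T_{2m}| ≤ m + 1`, the two-square identity, and the root count from Mathlib's
`Polynomial.Chebyshev.roots_T_real`.

Companion files: `LoadBearing.lean` (multiplicity; `c ≠ 0`), `SOSTauFalseOverComplex.lean`,
`SOSTauFalseWithSupportUnion.lean`.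
-/

set_option linter.dupNamespace false

namespace Summit.ValiantsHypothesis.ValiantsHypothesis.Theorems.SOSTau.Negative

open Polynomial Polynomial.Chebyshev Finset Real

/-- Parity of the Chebyshev coefficients: `coeff (T n) k = 0` whenever `n + k` is odd
(`T_n(−x) = (−1)^n T_n(x)`), by the two-step recursion. [folklore] -/
theorem coeff_chebyshevT_eq_zero_of_odd_add :
    ∀ n k : ℕ, Odd (n + k) → (T ℝ n).coeff k = 0
  | 0, k, h => by
    rw [Nat.cast_zero, T_zero, coeff_one, if_neg]
    rintro rfl
    simp at h
  | 1, k, h => by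
    rw [Nat.cast_one, T_one, coeff_X, if_neg]
    rintro rfl
    norm_num at h
  | n + 2, k, h => by
    have hc : ((n + 2 : ℕ) : ℤ) = (n : ℤ) + 2 := by push_cast; ring
    rw [hc, T_add_two, coeff_sub]
    have h1 : ((n : ℤ) + 1) = ((n + 1 : ℕ) : ℤ) := by push_cast; ring
    rw [h1]
    cases k with
    | zero =>
      rw [mul_assoc, mul_comm, coeff_mul_ofNat, coeff_X_mul_zero, zero_mul, zero_sub,
        neg_eq_zero]
      exact coeff_chebyshevT_eq_zero_of_odd_add n 0 (by simpa [Nat.odd_add] using h)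
    | succ j =>
      rw [mul_assoc, mul_comm, coeff_mul_ofNat, coeff_X_mul,
        coeff_chebyshevT_eq_zero_of_odd_add (n + 1) j ?_,
        coeff_chebyshevT_eq_zero_of_odd_add n (j + 1) ?_]
      · simp
      · have : n + 2 + (j + 1) = (n + (j + 1)) + 2 := by ring
        rw [this, Nat.odd_add] at h
        simpa using h
      · have : n + 2 + (j + 1) = (n + 1 + j) + 2 := by ring
        rw [this, Nat.odd_add] at h
        simpa using h

/-- `T_{2m}` is an even polynomial of degree `2m`: at most `m + 1` monomials. [folklore] -/
theorem card_support_chebyshevT_two_mul_le (m : ℕ) :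
    (T ℝ ((2 * m : ℕ) : ℤ)).support.card ≤ m + 1 := by
  have hsub : (T ℝ ((2 * m : ℕ) : ℤ)).support ⊆ (Finset.range (m + 1)).image (fun j => 2 * j) := by
    intro k hk
    rw [mem_support_iff] at hk
    have hk_le : k ≤ 2 * m := by
      have := le_natDegree_of_ne_zero hk
      rwa [natDegree_T, Int.natAbs_natCast] at this
    have hk_even : Even k := by
      by_contra hodd
      rw [Nat.not_even_iff_odd] at hodd
      exact hk (coeff_chebyshevT_eq_zero_of_odd_add (2 * m) k (by
        rw [Nat.odd_add']
        exact iff_of_true hodd (even_two_mul m)))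
    obtain ⟨j, rfl⟩ := hk_even
    exact Finset.mem_image.mpr ⟨j, Finset.mem_range.mpr (by omega), by ring⟩
  calc (T ℝ ((2 * m : ℕ) : ℤ)).support.card
      ≤ ((Finset.range (m + 1)).image (fun j => 2 * j)).card := Finset.card_le_card hsub
    _ ≤ (Finset.range (m + 1)).card := Finset.card_image_le
    _ = m + 1 := Finset.card_range _

/-- `T_n` has exactly `n` distinct real zeros (Mathlib `roots_T_real`). [folklore] -/
theorem card_roots_toFinset_chebyshevT (n : ℕ) : (T ℝ (n : ℤ)).roots.toFinset.card = n := by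
  rw [roots_T_real, Finset.val_toFinset,
    Finset.card_image_of_injOn
      ((Finset.range _).nodup_map_iff_injOn.mp (roots_T_real_nodup _)),
    Finset.card_range]

/-- The Chebyshev doubling `T_{4m} = 2·T_{2m}² + (−1)·1²` as a weighted two-square
representation. [folklore] -/
theorem chebyshevT_four_mul_eq_sos (m : ℕ) :
    (∑ i : Fin 2, C ((![2, -1] : Fin 2 → ℝ) i) *
        (![T ℝ ((2 * m : ℕ) : ℤ), 1] : Fin 2 → ℝ[X]) i ^ 2) = T ℝ ((4 * m : ℕ) : ℤ) := by
  have h4 : ((4 * m : ℕ) : ℤ) = 2 * ((2 * m : ℕ) : ℤ) := by push_cast; ring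
  rw [h4, T_mul, T_two]
  simp only [Fin.sum_univ_two, Matrix.cons_val_zero, Matrix.cons_val_one, one_pow, mul_one,
    sub_comp, mul_comp, pow_comp, X_comp, one_comp, ofNat_comp, map_neg, map_one]
  rw [map_ofNat Polynomial.C 2]
  push_cast
  ring

/-- Support-sum of the Chebyshev representation: `|supp T_{2m}| + |supp 1| ≤ m + 2`. [folklore] -/
theorem supportSum_chebyshev_sos_le (m : ℕ) :
    (∑ i : Fin 2, ((![T ℝ ((2 * m : ℕ) : ℤ), 1] : Fin 2 → ℝ[X]) i).support.card) ≤ m + 2 := by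
  simp only [Fin.sum_univ_two, Matrix.cons_val_zero, Matrix.cons_val_one]
  have h1 : (1 : ℝ[X]).support.card ≤ 1 := by
    rw [← Polynomial.C_1]
    exact (Finset.card_le_card (Polynomial.support_C_subset (1 : ℝ))).trans (by simp)
  have := card_support_chebyshevT_two_mul_le m
  omega

/-- TIGHTNESS at the Chebyshev family: an admissible constant `c` of `SOSTau` satisfies
`4m ≤ c·(m + 2)` for every `m` — the ratio (distinct real zeros)/(support-sum) tends to `4`
along `T_{4m} = 2T_{2m}² − 1`, so no constant below `4` is admissible and `4` cannot be
improved. [folklore] -/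
theorem four_mul_le_of_sosTauConst {c : ℕ}
    (hc : ∀ (s : ℕ) (a : Fin s → ℝ) (g : Fin s → Polynomial ℝ),
      (∑ i, Polynomial.C (a i) * g i ^ 2).roots.toFinset.card ≤ c * ∑ i, (g i).support.card)
    (m : ℕ) : 4 * m ≤ c * (m + 2) := by
  have h := hc 2 ![2, -1] ![T ℝ ((2 * m : ℕ) : ℤ), 1]
  rw [chebyshevT_four_mul_eq_sos, card_roots_toFinset_chebyshevT] at h
  exact h.trans (Nat.mul_le_mul_left c (supportSum_chebyshev_sos_le m))

/-- The natural strengthening "`SOSTau` with constant `3`" is FALSE: `T₂₈ = 2·T₁₄² − 1·1²` has 28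
distinct real zeros and support-sum `≤ 8 + 1 = 9`, `3·9 = 27 < 28`. [folklore] -/
theorem not_sosTau_const_three :
    ¬ ∀ (s : ℕ) (a : Fin s → ℝ) (g : Fin s → Polynomial ℝ),
      (∑ i, Polynomial.C (a i) * g i ^ 2).roots.toFinset.card ≤ 3 * ∑ i, (g i).support.card := by
  intro h3
  have := four_mul_le_of_sosTauConst h3 7
  omega

end Summit.ValiantsHypothesis.ValiantsHypothesis.Theorems.SOSTau.Negative
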